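import Mathlib
import HarnessLib
import Literature.Analysis.Calculus.CenterLipschitzLocalNewton
import Literature.Analysis.Calculus.KantorovichMajorantPrinciple
import Literature.Analysis.Calculus.MajorantNewtonSequence

/-!
# General semilocal convergence of Newton's method under a majorant function (Ezquerro–Hernández 2017, Theorem 1.27)

Topic `Literature/Analysis/Calculus`.  J. A. Ezquerro Fernández and M. Á. Hernández Verón, *Newton's
Method: an Updated Approach of Kantorovich's Theory*, Birkhäuser (2017)
[EzquerrofernandezHernandezveron2017], §1.1.4 ("New approach: a majorant function from an initial value
problem"), prove the following generalisation of the Newton–Kantorovich theorem, in which Kantorovich's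
quadratic polynomial is replaced by an arbitrary scalar function `f` majorizing `F''`:

**Theorem 1.27 (General semilocal convergence).**  Let `F : Ω ⊆ X → Y` be twice continuously Fréchet
differentiable on an open convex domain of a Banach space, and let `f ∈ 𝒞²([t₀, ∞))` satisfy
(a) `Γ₀ = F'(x₀)⁻¹` exists with `‖Γ₀‖ ≤ −1/f'(t₀)` and `‖Γ₀F(x₀)‖ ≤ −f(t₀)/f'(t₀)`;
(b) `‖F''(x)‖ ≤ f''(t)` whenever `‖x − x₀‖ ≤ t − t₀`.
If `f(t) = 0` has only one solution `t*` in `[t₀, ∞)` (so `t*` is its smallest zero) and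
`B(x₀, t* − t₀) ⊂ Ω`, then Newton's method `x_{n+1} = xₙ − F'(xₙ)⁻¹F(xₙ)` starting at `x₀` converges
to a solution `x*` of `F(x) = 0`, and `‖x* − xₙ‖ ≤ t* − tₙ` (`n ≥ 0`), where
`t_{n+1} = tₙ − f(tₙ)/f'(tₙ)` (1.34).  The proof establishes by induction the system (1.35):
`Γₙ` exists with `‖Γₙ‖ ≤ −1/f'(tₙ)`, `‖x_{n+1} − xₙ‖ ≤ t_{n+1} − tₙ`, `‖xₙ − x₀‖ ≤ tₙ − t₀`, via
`‖F'(x) − F'(x₀)‖ ≤ f'(t) − f'(t₀)`, the Banach lemma, and the Taylor estimate `‖F(xₙ)‖ ≤ f(tₙ)`.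

Held copy: `lit read book:ezquerro-fernandez2017-newtons-method-updated-approach-kantorovichs-theory`,
pp. 53–55 (Definition 1.26, Theorem 1.27 with proof).

## Rendering (what is typed)

* `X` Banach, `Y` normed; `F`, `F'`, `F''` with `HasFDerivAt F (F' x) x` and `HasFDerivAt F' (F'' x) x`
  at every point of the closed ball `closedBall x₀ (t* − t₀)` (the book's open-ball inclusion in `Ω`
  is replaced by hypotheses on the closed ball, which is where all iterates and the limit live);
  `f f' f'' : ℝ → ℝ` with `HasDerivAt` on `Icc t₀ t*`; "`t*` the unique zero of `f` in `[t₀, ∞)`" is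
  typed as `f t* = 0 ∧ ∀ s ∈ [t₀, t*), 0 < f s` (only the smallest zero matters); (a) with the operator
  norm of `(F' x₀).inverse`; (b) literally.  The signs `f' < 0` on `[t₀, t*)` and the convexity of `f`
  are consequences ((b) at `x = x₀` gives `f'' ≥ 0`), imported from `MajorantNewtonSequence.lean` and
  `KantorovichMajorantPrinciple.lean`.
* The Banach lemma is taken about `F'(x₀)` (Kantorovich's original form,
  `‖Γ₀‖‖F'(x) − F'(x₀)‖ ≤ 1 − f'(t)/f'(t₀) < 1`, giving the same bound `‖F'(x)⁻¹‖ ≤ −1/f'(t)`); the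
  book perturbs about `Γ_{n−1}` instead.  The Taylor estimate is proved without integrals by the
  fencing theorem (`image_norm_le_of_norm_deriv_right_le_deriv_boundary'`):
  `‖F(b) − F(a) − F'(a)(b − a)‖ ≤ f(β) − f(α) − f'(α)(β − α)` for `‖a − x₀‖ ≤ α − t₀`, `‖b − a‖ ≤ β − α`.
* Newton sequences are hypotheses `x (n+1) = x n − (F' (x n)).inverse (F (x n))`,
  `t (n+1) = t n − f (t n) / f' (t n)` (`inverse` of a non-invertible map is `0`, which only matters in
  the stationary case `tₙ = t*`, where `F(xₙ) = 0`).

## Contents (everything below is proved; no definitions, no named facts)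

the derivative comparison `‖F'(b) − F'(a)‖ ≤ f'(β) − f'(α)`, the second-order remainder estimate, the
inverse bound `‖F'(x)⁻¹‖ ≤ −1/f'(t)`, the induction (1.35), the residual bound `‖F(x_{n+1})‖ ≤ f(t_{n+1})`,
ball membership, `‖x_m − xₙ‖ ≤ t_m − tₙ`, Theorem 1.27, and its centred form Theorem 2.13 (conditions
(D1)–(D2) of Chapter 2: `‖F''(x₀)‖ ≤ f''(t₀)`, `‖F''(x) − F''(x₀)‖ ≤ f''(t) − f''(t₀)` imply (b)).
-/

open Set Filter Metric Topology

namespace Literature.Analysis.Calculus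

/-! ## Second-order majorant estimates -/

section SecondOrder

variable {X Y : Type*} [NormedAddCommGroup X] [NormedSpace ℝ X] [NormedAddCommGroup Y]
  [NormedSpace ℝ Y] {F : X → Y} {F' : X → X →L[ℝ] Y} {F'' : X → X →L[ℝ] (X →L[ℝ] Y)}
  {g g' g'' : ℝ → ℝ} {x₀ : X} {t₀ t' : ℝ}

/-- **Derivative comparison:** under (b) `‖F''(x)‖ ≤ g''(t)` for `‖x − x₀‖ ≤ t − t₀`, one has
`‖F'(b) − F'(a)‖ ≤ g'(β) − g'(α)` whenever `t₀ ≤ α ≤ β ≤ t'`, `‖a − x₀‖ ≤ α − t₀`, `‖b − a‖ ≤ β − α`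
(the book's `‖F'(xₙ) − F'(x₀)‖`, `‖I − Γ_{n−1}F'(xₙ)‖` estimates: `∫ f'' = f'(tₙ) − f'(t_{n−1})`).
[cite: EzquerrofernandezHernandezveron2017, §1.1.4 proof of Theorem 1.27 (p. 55, the estimate of ‖I − Γ_{n−1}F'(xₙ)‖ and the mean value bound for ‖F'(xₙ) − F'(x₀)‖)] -/
theorem majorantNewton_fderiv_sub_le
    (hF2 : ∀ x ∈ closedBall x₀ (t' - t₀), HasFDerivAt F' (F'' x) x)
    (hg2 : ∀ t ∈ Icc t₀ t', HasDerivAt g' (g'' t) t)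
    (hb : ∀ x, ∀ t ∈ Icc t₀ t', ‖x - x₀‖ ≤ t - t₀ → ‖F'' x‖ ≤ g'' t)
    {a b : X} {α β : ℝ} (hα : t₀ ≤ α) (hαβ : α ≤ β) (hβ : β ≤ t') (ha : ‖a - x₀‖ ≤ α - t₀)
    (hab : ‖b - a‖ ≤ β - α) : ‖F' b - F' a‖ ≤ g' β - g' α :=
  majorant_image_sub_le hF2 hg2 hb hα hαβ hβ ha hab

/-- **Second-order remainder under a majorant of `F''`** (the Taylor estimate of the proof of
Theorem 1.27, `‖F(xₙ)‖ = ‖∫ F''(x)(xₙ − x)dx‖ ≤ ∫ f''(τ)(tₙ − τ)dτ`, in two-point form):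
`‖F(b) − F(a) − F'(a)(b − a)‖ ≤ g(β) − g(α) − g'(α)(β − α)` for `t₀ ≤ α ≤ β ≤ t'`, `‖a − x₀‖ ≤ α − t₀`,
`‖b − a‖ ≤ β − α`.
[cite: EzquerrofernandezHernandezveron2017, §1.1.4 proof of Theorem 1.27 (p. 55, "by Taylor's series … ‖F(xₙ)‖ ≤ ∫ f''(τ)(tₙ − τ)dτ = f(tₙ)")] -/
theorem majorantNewton_remainder_le
    (hF : ∀ x ∈ closedBall x₀ (t' - t₀), HasFDerivAt F (F' x) x)
    (hF2 : ∀ x ∈ closedBall x₀ (t' - t₀), HasFDerivAt F' (F'' x) x)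
    (hg : ∀ t ∈ Icc t₀ t', HasDerivAt g (g' t) t)
    (hg2 : ∀ t ∈ Icc t₀ t', HasDerivAt g' (g'' t) t)
    (hb : ∀ x, ∀ t ∈ Icc t₀ t', ‖x - x₀‖ ≤ t - t₀ → ‖F'' x‖ ≤ g'' t)
    {a b : X} {α β : ℝ} (hα : t₀ ≤ α) (hαβ : α ≤ β) (hβ : β ≤ t') (ha : ‖a - x₀‖ ≤ α - t₀)
    (hab : ‖b - a‖ ≤ β - α) :
    ‖F b - F a - F' a (b - a)‖ ≤ g β - g α - g' α * (β - α) := by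
  set γ : ℝ → X := fun τ => a + τ • (b - a) with hγ
  set σ : ℝ → ℝ := fun τ => α + τ * (β - α) with hσ
  have hγ' : ∀ τ, HasDerivAt γ (b - a) τ := fun τ => by
    simpa [hγ] using ((hasDerivAt_id τ).smul_const (b - a)).const_add a
  have hσ' : ∀ τ, HasDerivAt σ (β - α) τ := fun τ => by
    simpa [hσ] using ((hasDerivAt_id τ).mul_const (β - α)).const_add α
  have hσmem : ∀ τ ∈ Icc (0:ℝ) 1, α ≤ σ τ ∧ σ τ ≤ t' := by
    intro τ hτ
    refine ⟨?_, ?_⟩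
    · have : 0 ≤ τ * (β - α) := mul_nonneg hτ.1 (sub_nonneg.2 hαβ)
      simp only [hσ]; linarith
    · have : τ * (β - α) ≤ 1 * (β - α) := mul_le_mul_of_nonneg_right hτ.2 (sub_nonneg.2 hαβ)
      simp only [hσ]; linarith
  have hγdist : ∀ τ ∈ Icc (0:ℝ) 1, ‖γ τ - a‖ ≤ σ τ - α := by
    intro τ hτ
    have h1 : γ τ - a = τ • (b - a) := by simp only [hγ]; abel
    rw [h1, norm_smul, Real.norm_of_nonneg hτ.1]
    have : τ * ‖b - a‖ ≤ τ * (β - α) := mul_le_mul_of_nonneg_left hab hτ.1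
    simp only [hσ]; linarith
  have hγmem : ∀ τ ∈ Icc (0:ℝ) 1, γ τ ∈ closedBall x₀ (t' - t₀) := by
    intro τ hτ
    refine mem_closedBall.2 ?_
    rw [dist_eq_norm]
    have h1 : γ τ - x₀ = (γ τ - a) + (a - x₀) := by abel
    rw [h1]
    refine (norm_add_le _ _).trans ?_
    linarith [hγdist τ hτ, (hσmem τ hτ).2]
  -- `ψ(τ) = F(γ τ) − F(a) − τ F'(a)(b − a)` and `B(τ) = g(σ τ) − g(α) − τ g'(α)(β − α)`
  have hψ' : ∀ τ ∈ Icc (0:ℝ) 1, HasDerivAt (fun τ => F (γ τ) - F a - τ • F' a (b - a))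
      (F' (γ τ) (b - a) - F' a (b - a)) τ := by
    intro τ hτ
    have h1 : HasDerivAt (fun τ => F (γ τ)) (F' (γ τ) (b - a)) τ :=
      (hF _ (hγmem τ hτ)).comp_hasDerivAt τ (hγ' τ)
    have h2 : HasDerivAt (fun τ : ℝ => τ • F' a (b - a)) (F' a (b - a)) τ := by
      simpa using (hasDerivAt_id τ).smul_const (F' a (b - a))
    exact (h1.sub_const (F a)).sub h2
  have hB' : ∀ τ ∈ Icc (0:ℝ) 1, HasDerivAt (fun τ => g (σ τ) - g α - τ * (g' α * (β - α)))
      (g' (σ τ) * (β - α) - g' α * (β - α)) τ := by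
    intro τ hτ
    have h1 := ((hg _ ⟨hα.trans (hσmem τ hτ).1, (hσmem τ hτ).2⟩).comp τ (hσ' τ)).sub_const (g α)
    have h2 : HasDerivAt (fun τ : ℝ => τ * (g' α * (β - α))) (g' α * (β - α)) τ := by
      simpa using (hasDerivAt_id τ).mul_const (g' α * (β - α))
    exact h1.sub h2
  have key := image_norm_le_of_norm_deriv_right_le_deriv_boundary'
    (f := fun τ => F (γ τ) - F a - τ • F' a (b - a)) (a := 0) (b := 1)
    (f' := fun τ => F' (γ τ) (b - a) - F' a (b - a))
    (fun τ hτ => (hψ' τ hτ).continuousAt.continuousWithinAt)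
    (fun τ hτ => (hψ' τ (Ico_subset_Icc_self hτ)).hasDerivWithinAt)
    (B := fun τ => g (σ τ) - g α - τ * (g' α * (β - α)))
    (B' := fun τ => g' (σ τ) * (β - α) - g' α * (β - α))
    (by simp [hγ, hσ])
    (fun τ hτ => (hB' τ hτ).continuousAt.continuousWithinAt)
    (fun τ hτ => (hB' τ (Ico_subset_Icc_self hτ)).hasDerivWithinAt)
    (fun τ hτ => by
      have hτ' := Ico_subset_Icc_self hτ
      have h1 : ‖F' (γ τ) - F' a‖ ≤ g' (σ τ) - g' α :=
        majorantNewton_fderiv_sub_le hF2 hg2 hb hα (hσmem τ hτ').1 (hσmem τ hτ').2 ha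
          (hγdist τ hτ')
      calc ‖F' (γ τ) (b - a) - F' a (b - a)‖ = ‖(F' (γ τ) - F' a) (b - a)‖ := by
              rw [sub_apply]
        _ ≤ ‖F' (γ τ) - F' a‖ * ‖b - a‖ := (F' (γ τ) - F' a).le_opNorm _
        _ ≤ (g' (σ τ) - g' α) * (β - α) :=
            mul_le_mul h1 hab (norm_nonneg _) ((norm_nonneg _).trans h1)
        _ = g' (σ τ) * (β - α) - g' α * (β - α) := by ring)
    (right_mem_Icc.2 zero_le_one)
  simpa [hγ, hσ] using key

end SecondOrder

/-! ## Theorem 1.27 -/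

section Semilocal

variable {X Y : Type*} [NormedAddCommGroup X] [NormedSpace ℝ X] [NormedAddCommGroup Y]
  [NormedSpace ℝ Y] {F : X → Y} {F' : X → X →L[ℝ] Y} {F'' : X → X →L[ℝ] (X →L[ℝ] Y)}
  {f f' f'' : ℝ → ℝ} {x₀ : X} {t₀ tstar : ℝ} {x : ℕ → X} {t : ℕ → ℝ}

/-- **The inverse bound of (1.35):** if `‖z − x₀‖ ≤ s − t₀` with `s ∈ [t₀, t*)`, then `F'(z)` is
invertible and `‖F'(z)⁻¹‖ ≤ −1/f'(s)` (Banach lemma about `F'(x₀)`: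
`‖Γ₀‖‖F'(z) − F'(x₀)‖ ≤ (f'(s) − f'(t₀))/(−f'(t₀)) = 1 − f'(s)/f'(t₀) < 1`).
[cite: EzquerrofernandezHernandezveron2017, §1.1.4 Theorem 1.27, proof (1.35) ("there exists the operator Γₙ and ‖Γₙ‖ ≤ −1/f'(tₙ)")] -/
theorem majorantNewton_inverse_le [CompleteSpace X]
    (hF2 : ∀ z ∈ closedBall x₀ (tstar - t₀), HasFDerivAt F' (F'' z) z)
    (hf : ∀ s ∈ Icc t₀ tstar, HasDerivAt f (f' s) s)
    (hf2 : ∀ s ∈ Icc t₀ tstar, HasDerivAt f' (f'' s) s)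
    (hzero : f tstar = 0) (hpos : ∀ s ∈ Ico t₀ tstar, 0 < f s)
    (hA : (F' x₀).IsInvertible) (ha1 : ‖(F' x₀).inverse‖ ≤ -1 / f' t₀)
    (hb : ∀ z, ∀ s ∈ Icc t₀ tstar, ‖z - x₀‖ ≤ s - t₀ → ‖F'' z‖ ≤ f'' s)
    {z : X} {s : ℝ} (hs : s ∈ Ico t₀ tstar) (hz : ‖z - x₀‖ ≤ s - t₀) :
    (F' z).IsInvertible ∧ ‖(F' z).inverse‖ ≤ -1 / f' s := by
  have hmono : MonotoneOn f' (Icc t₀ tstar) := majorant_monotoneOn hF2 hf2 hb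
  have hds : f' s < 0 := (newtonMajorant_deriv_neg hf hmono hzero hpos hs).2
  have hd0 : f' t₀ < 0 :=
    (newtonMajorant_deriv_neg hf hmono hzero hpos ⟨le_rfl, lt_of_le_of_lt hs.1 hs.2⟩).2
  have hd0s : f' t₀ ≤ f' s := hmono ⟨le_rfl, hs.1.trans hs.2.le⟩ ⟨hs.1, hs.2.le⟩ hs.1
  -- `‖F'(z) − F'(x₀)‖ ≤ f'(s) − f'(t₀)`
  have hdiff : ‖F' z - F' x₀‖ ≤ f' s - f' t₀ :=
    majorantNewton_fderiv_sub_le hF2 hf2 hb le_rfl hs.1 hs.2.le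
      (by rw [sub_self, norm_zero, sub_self]) hz
  have hne0 : f' t₀ ≠ 0 := hd0.ne
  have hnes : f' s ≠ 0 := hds.ne
  set r : ℝ := -1 / f' t₀ * (f' s - f' t₀) with hr
  have hq : 0 < f' s / f' t₀ := div_pos_of_neg_of_neg hds hd0
  have hr1 : 1 - r = f' s / f' t₀ := by
    rw [hr]; field_simp; ring
  have hrlt : r < 1 := by linarith
  have hinv0 : 0 ≤ -1 / f' t₀ := div_nonneg_of_nonpos (by norm_num) hd0.le
  have hB : ‖(F' x₀).inverse.comp (F' z - F' x₀)‖ ≤ r :=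
    calc ‖(F' x₀).inverse.comp (F' z - F' x₀)‖ ≤ ‖(F' x₀).inverse‖ * ‖F' z - F' x₀‖ :=
          ContinuousLinearMap.opNorm_comp_le _ _
      _ ≤ -1 / f' t₀ * (f' s - f' t₀) :=
          mul_le_mul ha1 hdiff (norm_nonneg _) hinv0
  obtain ⟨hzinv, hzb⟩ := centerLipschitzLocal_perturbation hA hB hrlt
  refine ⟨hzinv, ContinuousLinearMap.opNorm_le_bound _
    (div_nonneg_of_nonpos (by norm_num) hds.le) fun w => ?_⟩
  calc ‖(F' z).inverse w‖ ≤ (1 - r)⁻¹ * ‖(F' x₀).inverse w‖ := hzb w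
    _ ≤ (1 - r)⁻¹ * (-1 / f' t₀ * ‖w‖) := by
        refine mul_le_mul_of_nonneg_left ?_ (inv_nonneg.2 (by rw [hr1]; exact hq.le))
        exact ((F' x₀).inverse.le_opNorm w).trans (mul_le_mul_of_nonneg_right ha1 (norm_nonneg _))
    _ = -1 / f' s * ‖w‖ := by
        rw [hr1]; field_simp

/-- The induction of the proof of Theorem 1.27: (1.35) `‖xₙ − x₀‖ ≤ tₙ − t₀`,
`‖x_{n+1} − xₙ‖ ≤ t_{n+1} − tₙ`, together with the Newton identity (1.28)
`F(xₙ) + F'(xₙ)(x_{n+1} − xₙ) = 0`.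
[cite: EzquerrofernandezHernandezveron2017, §1.1.4 Theorem 1.27, proof (1.35) and (1.28)] -/
private theorem mslAux_invariant [CompleteSpace X]
    (hF : ∀ z ∈ closedBall x₀ (tstar - t₀), HasFDerivAt F (F' z) z)
    (hF2 : ∀ z ∈ closedBall x₀ (tstar - t₀), HasFDerivAt F' (F'' z) z)
    (hf : ∀ s ∈ Icc t₀ tstar, HasDerivAt f (f' s) s)
    (hf2 : ∀ s ∈ Icc t₀ tstar, HasDerivAt f' (f'' s) s)
    (hzero : f tstar = 0) (hpos : ∀ s ∈ Ico t₀ tstar, 0 < f s) (ht0s : t₀ ≤ tstar)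
    (hA : (F' x₀).IsInvertible) (ha1 : ‖(F' x₀).inverse‖ ≤ -1 / f' t₀)
    (ha2 : ‖(F' x₀).inverse (F x₀)‖ ≤ -(f t₀ / f' t₀))
    (hb : ∀ z, ∀ s ∈ Icc t₀ tstar, ‖z - x₀‖ ≤ s - t₀ → ‖F'' z‖ ≤ f'' s)
    (ht0 : t 0 = t₀) (ht : ∀ n, t (n + 1) = t n - f (t n) / f' (t n))
    (hx0 : x 0 = x₀) (hx : ∀ n, x (n + 1) = x n - (F' (x n)).inverse (F (x n))) (n : ℕ) :
    ‖x n - x₀‖ ≤ t n - t₀ ∧ ‖x (n + 1) - x n‖ ≤ t (n + 1) - t n ∧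
      F (x n) + F' (x n) (x (n + 1) - x n) = 0 := by
  have hmono : MonotoneOn f' (Icc t₀ tstar) := majorant_monotoneOn hF2 hf2 hb
  have hmem := newtonMajorant_seq_mem_Icc hf hmono hzero hpos ht0s ht0 ht
  have hsucc := newtonMajorant_seq_le_succ hf hmono hzero hpos ht0s ht0 ht
  have hlin := newtonMajorant_seq_linearization hf hmono hzero hpos ht0s ht0 ht
  induction n with
  | zero =>
    refine ⟨by rw [hx0, ht0, sub_self, norm_zero, sub_self], ?_, ?_⟩
    · have e : x 1 - x 0 = -((F' x₀).inverse (F x₀)) := by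
        rw [hx 0, hx0]; abel
      rw [e, norm_neg, ht 0, ht0]
      have : t₀ - f t₀ / f' t₀ - t₀ = -(f t₀ / f' t₀) := by ring
      rw [this]; exact ha2
    · have e : x (0 + 1) - x 0 = -((F' x₀).inverse (F x₀)) := by
        rw [hx 0, hx0]; abel
      rw [e, hx0, map_neg, ← ContinuousLinearMap.comp_apply, hA.self_comp_inverse]
      simp
  | succ n ih =>
    obtain ⟨h1, h2, h3⟩ := ih
    -- (i) distance to the centre
    have hd : ‖x (n + 1) - x₀‖ ≤ t (n + 1) - t₀ := by
      have e : x (n + 1) - x₀ = (x (n + 1) - x n) + (x n - x₀) := by abel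
      rw [e]; exact (norm_add_le _ _).trans (by linarith)
    -- the residual bound `‖F(x_{n+1})‖ ≤ f(t_{n+1})`
    have hres : ‖F (x (n + 1))‖ ≤ f (t (n + 1)) := by
      have hrem := majorantNewton_remainder_le hF hF2 hf hf2 hb (hmem n).1 (hsucc n)
        (hmem (n + 1)).2 h1 h2
      have e1 : F (x (n + 1)) - F (x n) - F' (x n) (x (n + 1) - x n) = F (x (n + 1)) := by
        have : F (x n) + F' (x n) (x (n + 1) - x n) = 0 := h3
        rw [sub_sub, this, sub_zero]
      have e2 : f (t (n + 1)) - f (t n) - f' (t n) * (t (n + 1) - t n) = f (t (n + 1)) := by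
        linarith [hlin n]
      rwa [e1, e2] at hrem
    refine ⟨hd, ?_, ?_⟩
    · rcases (hmem (n + 1)).2.eq_or_lt with heq | hlt
      · -- stationary case `t_{n+1} = t*`: `F(x_{n+1}) = 0`
        have hF0 : F (x (n + 1)) = 0 := by
          rw [heq, hzero] at hres; exact norm_le_zero_iff.1 hres
        rw [hx (n + 1), hF0, map_zero, sub_zero, sub_self, norm_zero]
        linarith [hsucc (n + 1)]
      · obtain ⟨_, hΓ⟩ := majorantNewton_inverse_le hF2 hf hf2 hzero hpos hA ha1 hb
          ⟨(hmem (n + 1)).1, hlt⟩ hd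
        have hds : f' (t (n + 1)) < 0 :=
          (newtonMajorant_deriv_neg hf hmono hzero hpos ⟨(hmem (n + 1)).1, hlt⟩).2
        have e : x (n + 2) - x (n + 1) = -((F' (x (n + 1))).inverse (F (x (n + 1)))) := by
          rw [hx (n + 1)]; abel
        rw [e, norm_neg]
        calc ‖(F' (x (n + 1))).inverse (F (x (n + 1)))‖
            ≤ ‖(F' (x (n + 1))).inverse‖ * ‖F (x (n + 1))‖ := ContinuousLinearMap.le_opNorm _ _
          _ ≤ -1 / f' (t (n + 1)) * f (t (n + 1)) :=
              mul_le_mul hΓ hres (norm_nonneg _) (div_nonneg_of_nonpos (by norm_num) hds.le)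
          _ = t (n + 2) - t (n + 1) := by
              rw [ht (n + 1)]; field_simp; ring
    · rcases (hmem (n + 1)).2.eq_or_lt with heq | hlt
      · have hF0 : F (x (n + 1)) = 0 := by
          rw [heq, hzero] at hres; exact norm_le_zero_iff.1 hres
        have e : x (n + 1 + 1) - x (n + 1) = 0 := by
          rw [hx (n + 1), hF0, map_zero, sub_zero, sub_self]
        rw [e, hF0, map_zero, add_zero]
      · obtain ⟨hinv, _⟩ := majorantNewton_inverse_le hF2 hf hf2 hzero hpos hA ha1 hb
          ⟨(hmem (n + 1)).1, hlt⟩ hd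
        have e : x (n + 1 + 1) - x (n + 1) = -((F' (x (n + 1))).inverse (F (x (n + 1)))) := by
          rw [hx (n + 1)]; abel
        rw [e, map_neg, ← ContinuousLinearMap.comp_apply, hinv.self_comp_inverse]
        simp

/-- **(1.35): the Newton sequence is majorized by (1.34)** — `‖x_{n+1} − xₙ‖ ≤ t_{n+1} − tₙ` and
`‖xₙ − x₀‖ ≤ tₙ − t₀` for every `n`.
[cite: EzquerrofernandezHernandezveron2017, §1.1.4 Theorem 1.27, proof (1.35) ("sequence (1.34) majorizes the sequence {xₙ}")] -/
theorem majorantNewton_majorizes [CompleteSpace X]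
    (hF : ∀ z ∈ closedBall x₀ (tstar - t₀), HasFDerivAt F (F' z) z)
    (hF2 : ∀ z ∈ closedBall x₀ (tstar - t₀), HasFDerivAt F' (F'' z) z)
    (hf : ∀ s ∈ Icc t₀ tstar, HasDerivAt f (f' s) s)
    (hf2 : ∀ s ∈ Icc t₀ tstar, HasDerivAt f' (f'' s) s)
    (hzero : f tstar = 0) (hpos : ∀ s ∈ Ico t₀ tstar, 0 < f s) (ht0s : t₀ ≤ tstar)
    (hA : (F' x₀).IsInvertible) (ha1 : ‖(F' x₀).inverse‖ ≤ -1 / f' t₀)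
    (ha2 : ‖(F' x₀).inverse (F x₀)‖ ≤ -(f t₀ / f' t₀))
    (hb : ∀ z, ∀ s ∈ Icc t₀ tstar, ‖z - x₀‖ ≤ s - t₀ → ‖F'' z‖ ≤ f'' s)
    (ht0 : t 0 = t₀) (ht : ∀ n, t (n + 1) = t n - f (t n) / f' (t n))
    (hx0 : x 0 = x₀) (hx : ∀ n, x (n + 1) = x n - (F' (x n)).inverse (F (x n))) (n : ℕ) :
    ‖x (n + 1) - x n‖ ≤ t (n + 1) - t n ∧ ‖x n - x₀‖ ≤ t n - t₀ :=
  let h := mslAux_invariant hF hF2 hf hf2 hzero hpos ht0s hA ha1 ha2 hb ht0 ht hx0 hx n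
  ⟨h.2.1, h.1⟩

/-- **The Newton identity (1.28) and the residual bound:** `F(xₙ) + F'(xₙ)(x_{n+1} − xₙ) = 0` and
`‖F(x_{n+1})‖ ≤ f(t_{n+1})` for every `n`.
[cite: EzquerrofernandezHernandezveron2017, §1.1.4 Theorem 1.27, proof ((1.28) and "‖F(xₙ)‖ ≤ f(tₙ)", p. 55)] -/
theorem majorantNewton_residual_le [CompleteSpace X]
    (hF : ∀ z ∈ closedBall x₀ (tstar - t₀), HasFDerivAt F (F' z) z)
    (hF2 : ∀ z ∈ closedBall x₀ (tstar - t₀), HasFDerivAt F' (F'' z) z)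
    (hf : ∀ s ∈ Icc t₀ tstar, HasDerivAt f (f' s) s)
    (hf2 : ∀ s ∈ Icc t₀ tstar, HasDerivAt f' (f'' s) s)
    (hzero : f tstar = 0) (hpos : ∀ s ∈ Ico t₀ tstar, 0 < f s) (ht0s : t₀ ≤ tstar)
    (hA : (F' x₀).IsInvertible) (ha1 : ‖(F' x₀).inverse‖ ≤ -1 / f' t₀)
    (ha2 : ‖(F' x₀).inverse (F x₀)‖ ≤ -(f t₀ / f' t₀))
    (hb : ∀ z, ∀ s ∈ Icc t₀ tstar, ‖z - x₀‖ ≤ s - t₀ → ‖F'' z‖ ≤ f'' s)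
    (ht0 : t 0 = t₀) (ht : ∀ n, t (n + 1) = t n - f (t n) / f' (t n))
    (hx0 : x 0 = x₀) (hx : ∀ n, x (n + 1) = x n - (F' (x n)).inverse (F (x n))) (n : ℕ) :
    F (x n) + F' (x n) (x (n + 1) - x n) = 0 ∧ ‖F (x (n + 1))‖ ≤ f (t (n + 1)) := by
  have hmono : MonotoneOn f' (Icc t₀ tstar) := majorant_monotoneOn hF2 hf2 hb
  have hmem := newtonMajorant_seq_mem_Icc hf hmono hzero hpos ht0s ht0 ht
  have hsucc := newtonMajorant_seq_le_succ hf hmono hzero hpos ht0s ht0 ht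
  have hlin := newtonMajorant_seq_linearization hf hmono hzero hpos ht0s ht0 ht n
  obtain ⟨h1, h2, h3⟩ := mslAux_invariant hF hF2 hf hf2 hzero hpos ht0s hA ha1 ha2 hb ht0 ht hx0 hx n
  refine ⟨h3, ?_⟩
  have hrem := majorantNewton_remainder_le hF hF2 hf hf2 hb (hmem n).1 (hsucc n) (hmem (n + 1)).2
    h1 h2
  have e1 : F (x (n + 1)) - F (x n) - F' (x n) (x (n + 1) - x n) = F (x (n + 1)) := by
    rw [sub_sub, h3, sub_zero]
  have e2 : f (t (n + 1)) - f (t n) - f' (t n) * (t (n + 1) - t n) = f (t (n + 1)) := by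
    linarith
  rwa [e1, e2] at hrem

/-- The iterates stay in the closed ball `B̄(x₀, t* − t₀)` ("`x_j ∈ B(x₀, t* − t₀) ⊂ Ω`").
[cite: EzquerrofernandezHernandezveron2017, §1.1.4 Theorem 1.27, proof ("xₙ₊₁ ∈ B(x₀, t* − t₀) ⊂ Ω")] -/
theorem majorantNewton_mem_closedBall [CompleteSpace X]
    (hF : ∀ z ∈ closedBall x₀ (tstar - t₀), HasFDerivAt F (F' z) z)
    (hF2 : ∀ z ∈ closedBall x₀ (tstar - t₀), HasFDerivAt F' (F'' z) z)
    (hf : ∀ s ∈ Icc t₀ tstar, HasDerivAt f (f' s) s)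
    (hf2 : ∀ s ∈ Icc t₀ tstar, HasDerivAt f' (f'' s) s)
    (hzero : f tstar = 0) (hpos : ∀ s ∈ Ico t₀ tstar, 0 < f s) (ht0s : t₀ ≤ tstar)
    (hA : (F' x₀).IsInvertible) (ha1 : ‖(F' x₀).inverse‖ ≤ -1 / f' t₀)
    (ha2 : ‖(F' x₀).inverse (F x₀)‖ ≤ -(f t₀ / f' t₀))
    (hb : ∀ z, ∀ s ∈ Icc t₀ tstar, ‖z - x₀‖ ≤ s - t₀ → ‖F'' z‖ ≤ f'' s)
    (ht0 : t 0 = t₀) (ht : ∀ n, t (n + 1) = t n - f (t n) / f' (t n))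
    (hx0 : x 0 = x₀) (hx : ∀ n, x (n + 1) = x n - (F' (x n)).inverse (F (x n))) (n : ℕ) :
    x n ∈ closedBall x₀ (tstar - t₀) := by
  have hmono : MonotoneOn f' (Icc t₀ tstar) := majorant_monotoneOn hF2 hf2 hb
  have hmem := newtonMajorant_seq_mem_Icc hf hmono hzero hpos ht0s ht0 ht n
  have h := (majorantNewton_majorizes hF hF2 hf hf2 hzero hpos ht0s hA ha1 ha2 hb ht0 ht hx0 hx n).2
  rw [mem_closedBall, dist_eq_norm]
  linarith [hmem.2]

/-- `‖x_m − xₙ‖ ≤ t_m − tₙ` for `n ≤ m` ((1.15) of Theorem 1.20 for the Newton sequence).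
[cite: EzquerrofernandezHernandezveron2017, §1.1.4 Theorem 1.27 (proof: "sequence (1.34) majorizes {xₙ}"); §1.1.2 Theorem 1.20 (1.15)] -/
theorem majorantNewton_dist_le [CompleteSpace X]
    (hF : ∀ z ∈ closedBall x₀ (tstar - t₀), HasFDerivAt F (F' z) z)
    (hF2 : ∀ z ∈ closedBall x₀ (tstar - t₀), HasFDerivAt F' (F'' z) z)
    (hf : ∀ s ∈ Icc t₀ tstar, HasDerivAt f (f' s) s)
    (hf2 : ∀ s ∈ Icc t₀ tstar, HasDerivAt f' (f'' s) s)
    (hzero : f tstar = 0) (hpos : ∀ s ∈ Ico t₀ tstar, 0 < f s) (ht0s : t₀ ≤ tstar)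
    (hA : (F' x₀).IsInvertible) (ha1 : ‖(F' x₀).inverse‖ ≤ -1 / f' t₀)
    (ha2 : ‖(F' x₀).inverse (F x₀)‖ ≤ -(f t₀ / f' t₀))
    (hb : ∀ z, ∀ s ∈ Icc t₀ tstar, ‖z - x₀‖ ≤ s - t₀ → ‖F'' z‖ ≤ f'' s)
    (ht0 : t 0 = t₀) (ht : ∀ n, t (n + 1) = t n - f (t n) / f' (t n))
    (hx0 : x 0 = x₀) (hx : ∀ n, x (n + 1) = x n - (F' (x n)).inverse (F (x n))) {n m : ℕ}
    (hnm : n ≤ m) : ‖x m - x n‖ ≤ t m - t n :=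
  majorizing_dist_le
    (fun k => (majorantNewton_majorizes hF hF2 hf hf2 hzero hpos ht0s hA ha1 ha2 hb ht0 ht hx0 hx k).1)
    hnm

/-- **Theorem 1.27 (General semilocal convergence).**  Under (a), (b) and the smallest zero `t*` of
the majorant function, Newton's method starting at `x₀` converges to a solution `x*` of `F(x) = 0`
lying in `B̄(x₀, t* − t₀)`, the scalar Newton sequence converges to `t*`, and
`‖x* − xₙ‖ ≤ t* − tₙ` for every `n`.
[cite: EzquerrofernandezHernandezveron2017, §1.1.4 Theorem 1.27 (General semilocal convergence) with proof (pp. 54–55)] -/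
theorem majorantNewton_semilocal [CompleteSpace X]
    (hF : ∀ z ∈ closedBall x₀ (tstar - t₀), HasFDerivAt F (F' z) z)
    (hF2 : ∀ z ∈ closedBall x₀ (tstar - t₀), HasFDerivAt F' (F'' z) z)
    (hf : ∀ s ∈ Icc t₀ tstar, HasDerivAt f (f' s) s)
    (hf2 : ∀ s ∈ Icc t₀ tstar, HasDerivAt f' (f'' s) s)
    (hzero : f tstar = 0) (hpos : ∀ s ∈ Ico t₀ tstar, 0 < f s) (ht0s : t₀ ≤ tstar)
    (hA : (F' x₀).IsInvertible) (ha1 : ‖(F' x₀).inverse‖ ≤ -1 / f' t₀)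
    (ha2 : ‖(F' x₀).inverse (F x₀)‖ ≤ -(f t₀ / f' t₀))
    (hb : ∀ z, ∀ s ∈ Icc t₀ tstar, ‖z - x₀‖ ≤ s - t₀ → ‖F'' z‖ ≤ f'' s)
    (ht0 : t 0 = t₀) (ht : ∀ n, t (n + 1) = t n - f (t n) / f' (t n))
    (hx0 : x 0 = x₀) (hx : ∀ n, x (n + 1) = x n - (F' (x n)).inverse (F (x n))) :
    Tendsto t atTop (𝓝 tstar) ∧
      ∃ xstar ∈ closedBall x₀ (tstar - t₀), Tendsto x atTop (𝓝 xstar) ∧ F xstar = 0 ∧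
        ∀ n, ‖xstar - x n‖ ≤ tstar - t n := by
  have hmono : MonotoneOn f' (Icc t₀ tstar) := majorant_monotoneOn hF2 hf2 hb
  have hT : Tendsto t atTop (𝓝 tstar) := newtonMajorant_seq_tendsto hf hmono hzero hpos ht0s ht0 ht
  have hmaj : ∀ k, ‖x (k + 1) - x k‖ ≤ t (k + 1) - t k := fun k =>
    (majorantNewton_majorizes hF hF2 hf hf2 hzero hpos ht0s hA ha1 ha2 hb ht0 ht hx0 hx k).1
  obtain ⟨xstar, hX, hball, hbound⟩ := majorizing_tendsto hmaj hT
  have hmem : xstar ∈ closedBall x₀ (tstar - t₀) := by rwa [hx0, ht0] at hball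
  refine ⟨hT, xstar, hmem, hX, ?_, hbound⟩
  -- `F(x*) = 0`: `‖F(x_{n+1})‖ ≤ f(t_{n+1}) → f(t*) = 0` and `F` is continuous at `x*`
  have hres : ∀ n, ‖F (x (n + 1))‖ ≤ f (t (n + 1)) := fun n =>
    (majorantNewton_residual_le hF hF2 hf hf2 hzero hpos ht0s hA ha1 ha2 hb ht0 ht hx0 hx n).2
  have hfc : ContinuousAt f tstar := (hf tstar ⟨ht0s, le_rfl⟩).continuousAt
  have hft : Tendsto (fun n => f (t (n + 1))) atTop (𝓝 0) := by
    have h := (hfc.tendsto.comp hT).comp (tendsto_add_atTop_nat 1)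
    rwa [hzero] at h
  have hFn : Tendsto (fun n => ‖F (x (n + 1))‖) atTop (𝓝 0) :=
    squeeze_zero (fun n => norm_nonneg _) hres hft
  have hFc : ContinuousAt F xstar := (hF xstar hmem).continuousAt
  have hFx : Tendsto (fun n => F (x (n + 1))) atTop (𝓝 (F xstar)) :=
    hFc.tendsto.comp (hX.comp (tendsto_add_atTop_nat 1))
  have h0 : Tendsto (fun n => F (x (n + 1))) atTop (𝓝 0) :=
    tendsto_zero_iff_norm_tendsto_zero.2 hFn
  exact tendsto_nhds_unique hFx h0

/-- **Theorem 2.13 (General semilocal convergence under the centred conditions (D1)–(D2)).**  If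
(D1) `Γ₀` exists with `‖Γ₀‖ ≤ −1/f'(t₀)`, `‖Γ₀F(x₀)‖ ≤ −f(t₀)/f'(t₀)` and `‖F''(x₀)‖ ≤ f''(t₀)`, and
(D2) `‖F''(x) − F''(x₀)‖ ≤ f''(t) − f''(t₀)` whenever `‖x − x₀‖ ≤ t − t₀`, then (b) of Theorem 1.27
holds (`‖F''(x)‖ ≤ ‖F''(x₀)‖ + ‖F''(x) − F''(x₀)‖ ≤ f''(t)`), so the conclusions of Theorem 1.27 hold
with `t*` the smallest zero of `f` in `[t₀, ∞)`: `tₙ → t*`, `xₙ → x*`, `F(x*) = 0`, `‖x* − xₙ‖ ≤ t* − tₙ`.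
[cite: EzquerrofernandezHernandezveron2017, §2.1.3 conditions (D1)–(D2), (2.13) and Theorem 2.13 (General semilocal convergence) with proof (p. 83); §1.1.4 Theorem 1.27] -/
theorem majorantNewton_semilocal_centered [CompleteSpace X]
    (hF : ∀ z ∈ closedBall x₀ (tstar - t₀), HasFDerivAt F (F' z) z)
    (hF2 : ∀ z ∈ closedBall x₀ (tstar - t₀), HasFDerivAt F' (F'' z) z)
    (hf : ∀ s ∈ Icc t₀ tstar, HasDerivAt f (f' s) s)
    (hf2 : ∀ s ∈ Icc t₀ tstar, HasDerivAt f' (f'' s) s)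
    (hzero : f tstar = 0) (hpos : ∀ s ∈ Ico t₀ tstar, 0 < f s) (ht0s : t₀ ≤ tstar)
    (hA : (F' x₀).IsInvertible) (ha1 : ‖(F' x₀).inverse‖ ≤ -1 / f' t₀)
    (ha2 : ‖(F' x₀).inverse (F x₀)‖ ≤ -(f t₀ / f' t₀)) (hδ : ‖F'' x₀‖ ≤ f'' t₀)
    (hD2 : ∀ z, ∀ s ∈ Icc t₀ tstar, ‖z - x₀‖ ≤ s - t₀ → ‖F'' z - F'' x₀‖ ≤ f'' s - f'' t₀)
    (ht0 : t 0 = t₀) (ht : ∀ n, t (n + 1) = t n - f (t n) / f' (t n))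
    (hx0 : x 0 = x₀) (hx : ∀ n, x (n + 1) = x n - (F' (x n)).inverse (F (x n))) :
    Tendsto t atTop (𝓝 tstar) ∧
      ∃ xstar ∈ closedBall x₀ (tstar - t₀), Tendsto x atTop (𝓝 xstar) ∧ F xstar = 0 ∧
        ∀ n, ‖xstar - x n‖ ≤ tstar - t n := by
  have hb : ∀ z, ∀ s ∈ Icc t₀ tstar, ‖z - x₀‖ ≤ s - t₀ → ‖F'' z‖ ≤ f'' s := by
    intro z s hs hz
    have h1 : ‖F'' z‖ ≤ ‖F'' x₀‖ + ‖F'' z - F'' x₀‖ := norm_le_insert' (F'' z) (F'' x₀)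
    linarith [hD2 z s hs hz]
  exact majorantNewton_semilocal hF hF2 hf hf2 hzero hpos ht0s hA ha1 ha2 hb ht0 ht hx0 hx

end Semilocal

end Literature.Analysis.Calculus
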